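import Literature.Analysis.PDE.NeumannHalfBallNormal
import Mathlib.Analysis.SpecialFunctions.SmoothTransition
import HarnessLib

/-!
# Tangential integration by parts on a half-ball against test functions free on the flat part,
# symmetry of the weak Hessian, and coefficient calculus

Topic `Analysis/PDE`. Theorem file (no definitions, no named facts; everything proved) supplying the
three tools of the induction step of the boundary regularity for the Neumann problem
(`NeumannHalfBallHigher.lean`, Evans, *PDE*, §6.3.2, Theorem 5), on the discharge path of
`Literature.Geometry.Riemannian.sharpLogSobolevAVR_four`:

* `HasWeakDerivAlong.integral_tangential_halfBall`: for a weak derivative `f'` of `f` along a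
  constant field `τ` TANGENT to the flat part of the half-ball `U = B(z,ρ) ∩ {⟪y - z, ν⟫ < 0}`
  (`⟪τ, ν⟫ = 0`) and a smooth `θ` compactly supported in the BALL `B(z,ρ)` (not necessarily vanishing
  on the flat part), `∫_U (∂_τ θ) f = -∫_U θ f'` — the boundary term on the flat part vanishes. Proof
  without any trace or divergence theorem: cut `θ` off in the NORMAL variable only
  (`θ χ_ε(⟪y - z, ν⟫)`, a genuine test function on `U` with `∂_τ(θχ_ε) = χ_ε ∂_τθ`) and let
  `ε → 0` by dominated convergence;
* `ae_inner_weakHessian_symm`: weak second derivatives are symmetric a.e. (from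
  `hasWeakDerivAlong_inner_swap` and a.e. uniqueness), and the resulting gradient form
  `hasWeakFDerivOn_const_inner_grad` of the weak derivative of a component `⟪τ, ∇u⟫`;
* `memSobolevDomain_clmField_apply`, `HasWeakDerivAlong.const_inner_clmField_apply`: applying a smooth
  field of linear maps to a Sobolev / weakly differentiable vector field.

## References

* L. C. Evans, *Partial Differential Equations*, 2nd ed. (2010), §6.3.2 Theorem 5 (proof),
  §5.2.1. [Evans2010]
* M. E. Taylor, *Partial Differential Equations I*, 2nd ed. (2011), Ch. 5 §7, (7.25)–(7.34).
  [TaylorPDEI2011]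
-/

noncomputable section

open MeasureTheory TopologicalSpace Set Function Filter Topology InnerProductSpace Metric
open scoped RealInnerProductSpace ENNReal NNReal ContDiff

namespace Literature.Analysis.PDE

open Literature.Analysis.FunctionSpaces Literature.Analysis.FluidPDE SobolevApprox

variable {H : Type*} [NormedAddCommGroup H] [InnerProductSpace ℝ H] [FiniteDimensional ℝ H]
  [MeasurableSpace H] [BorelSpace H]
variable {W : Type*} [NormedAddCommGroup W] [NormedSpace ℝ W] [CompleteSpace W]

/-! ### The normal cut-off -/

section NormalCutoff

omit [FiniteDimensional ℝ H] [MeasurableSpace H] [BorelSpace H]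

/-- The normal cut-off `χ_ε(y) = S((-⟪y - z, ν⟫ - ε)/ε)` (`S` = `Real.smoothTransition`): smooth,
`= 0` where `⟪y - z, ν⟫ ≥ -ε`, `= 1` where `⟪y - z, ν⟫ ≤ -2ε`, with values in `[0,1]`, and with
vanishing derivative along every `τ ⊥ ν`. [folklore] -/
theorem normalCutoff_props (ν z : H) {ε : ℝ} (hε : 0 < ε) :
    let χ : H → ℝ := fun y => Real.smoothTransition ((-⟪y - z, ν⟫ - ε) / ε)
    ContDiff ℝ ∞ χ ∧ (∀ y, 0 ≤ χ y ∧ χ y ≤ 1) ∧ (∀ y, -ε ≤ ⟪y - z, ν⟫ → χ y = 0) ∧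
      (∀ y, ⟪y - z, ν⟫ ≤ -(2 * ε) → χ y = 1) ∧
      (∀ τ : H, ⟪τ, ν⟫ = 0 → ∀ y, fderiv ℝ χ y τ = 0) := by
  intro χ
  have hℓ : ContDiff ℝ ∞ fun y : H => (-⟪y - z, ν⟫ - ε) / ε :=
    (((contDiff_id.sub contDiff_const).inner ℝ contDiff_const).neg.sub contDiff_const).div_const ε
  have hχ : ContDiff ℝ ∞ χ := Real.smoothTransition.contDiff.comp hℓ
  refine ⟨hχ, fun y => ⟨Real.smoothTransition.nonneg _, Real.smoothTransition.le_one _⟩,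
    fun y hy => Real.smoothTransition.zero_of_nonpos ?_,
    fun y hy => Real.smoothTransition.one_of_one_le ?_, fun τ hτ y => ?_⟩
  · exact div_nonpos_of_nonpos_of_nonneg (by linarith) hε.le
  · rw [le_div_iff₀ hε]; linarith
  · -- `χ` is constant along the line `s ↦ y + s τ`
    have hconst : (fun s : ℝ => χ (y + s • τ)) = fun _ => χ y := by
      funext s
      show Real.smoothTransition ((-⟪y + s • τ - z, ν⟫ - ε) / ε) =
        Real.smoothTransition ((-⟪y - z, ν⟫ - ε) / ε)
      rw [show y + s • τ - z = (y - z) + s • τ by abel, inner_add_left, real_inner_smul_left, hτ,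
        mul_zero, add_zero]
    have hγ : HasDerivAt (fun s : ℝ => y + s • τ) τ 0 := by
      have := ((hasDerivAt_id (0 : ℝ)).smul_const τ).const_add y
      simpa using this
    have hχd : DifferentiableAt ℝ χ (y + (0 : ℝ) • τ) := by
      rw [zero_smul, add_zero]; exact (hχ.differentiable (by simp)) y
    have hcomp : HasDerivAt (fun s : ℝ => χ (y + s • τ)) (fderiv ℝ χ y τ) 0 := by
      have h := hχd.hasFDerivAt.comp_hasDerivAt (0 : ℝ) hγ
      rw [zero_smul, add_zero] at h
      exact h
    rw [hconst] at hcomp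
    exact hcomp.unique (hasDerivAt_const 0 (χ y))

end NormalCutoff

/-! ### Tangential integration by parts against test functions free on the flat part -/

omit [FiniteDimensional ℝ H] [CompleteSpace W] in
/-- **Tangential integration by parts on the half-ball** (Evans, *PDE*, §6.3.2, proof of Theorem 5:
difference quotients / derivatives in the tangential directions need no boundary condition on the
flat part): if `f'` is a weak derivative of `f` on `U = B(z,ρ) ∩ {⟪y - z, ν⟫ < 0}` along the constant
tangential field `τ` (`⟪τ, ν⟫ = 0`), `f, f'` integrable on `U`, and `θ ∈ C_c^∞(B(z,ρ))` (free on the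
flat part), then `∫_U (∂_τ θ) f dμ = -∫_U θ f' dμ`. Proof: `θ χ_ε` (normal cut-off) is a test
function on `U` with `∂_τ(θ χ_ε) = χ_ε ∂_τ θ`; let `ε → 0` (dominated convergence).
[cite: Evans2010, §6.3.2 Theorem 5 (proof)] -/
theorem _root_.Literature.Analysis.FluidPDE.HasWeakDerivAlong.integral_tangential_halfBall {μ : Measure H} {ν z : H} {ρ : ℝ} {τ : H}
    (hτ : ⟪τ, ν⟫ = 0) {f f' : H → W}
    (hf : HasWeakDerivAlong (halfBall ν z ρ) μ (fun _ => τ) f f')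
    (hfi : IntegrableOn f (halfBall ν z ρ : Set H) μ) (hf'i : IntegrableOn f' (halfBall ν z ρ : Set H) μ)
    {θ : H → ℝ} (hθ : ContDiff ℝ ∞ θ) (hθc : HasCompactSupport θ) (hθs : tsupport θ ⊆ ball z ρ) :
    ∫ y in (halfBall ν z ρ : Set H), (fderiv ℝ θ y τ) • f y ∂μ =
      -∫ y in (halfBall ν z ρ : Set H), θ y • f' y ∂μ := by
  set U : Opens H := halfBall ν z ρ with hU
  have hUm : MeasurableSet (U : Set H) := U.isOpen.measurableSet
  have hθd : Differentiable ℝ θ := hθ.differentiable (by simp)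
  -- bounds for `θ` and `∂_τ θ`
  obtain ⟨Cθ, hCθ⟩ : ∃ C, ∀ y, ‖θ y‖ ≤ C := hθ.continuous.bounded_above_of_compact_support hθc
  have hDθc : Continuous fun y => fderiv ℝ θ y τ :=
    (hθ.continuous_fderiv (by simp)).clm_apply continuous_const
  obtain ⟨CD, hCD⟩ : ∃ C, ∀ y, ‖fderiv ℝ θ y τ‖ ≤ C :=
    hDθc.bounded_above_of_compact_support (hθc.fderiv_apply (𝕜 := ℝ) τ)
  -- the cut-offs
  set ε : ℕ → ℝ := fun n => 1 / ((n : ℝ) + 1) with hε_def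
  have hε : ∀ n, 0 < ε n := fun n => by rw [hε_def]; positivity
  have hεlim : Tendsto ε atTop (𝓝 0) := tendsto_one_div_add_atTop_nhds_zero_nat
  set χ : ℕ → H → ℝ := fun n y => Real.smoothTransition ((-⟪y - z, ν⟫ - ε n) / ε n) with hχ_def
  have hχp : ∀ n, ContDiff ℝ ∞ (χ n) ∧ (∀ y, 0 ≤ χ n y ∧ χ n y ≤ 1) ∧
      (∀ y, -ε n ≤ ⟪y - z, ν⟫ → χ n y = 0) ∧ (∀ y, ⟪y - z, ν⟫ ≤ -(2 * ε n) → χ n y = 1) ∧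
      (∀ τ : H, ⟪τ, ν⟫ = 0 → ∀ y, fderiv ℝ (χ n) y τ = 0) := fun n => normalCutoff_props ν z (hε n)
  -- `θ χₙ` is a test function on `U`
  have htest : ∀ n, IsTestFunctionOn U (fun y => θ y * χ n y) := fun n => by
    refine ⟨hθ.mul (hχp n).1, hθc.mul_right, fun y hy => ?_⟩
    have hyθ : y ∈ tsupport θ := tsupport_mul_subset_left hy
    have hyχ : y ∈ tsupport (χ n) := tsupport_mul_subset_right hy
    have hle : ⟪y - z, ν⟫ ≤ -ε n := by
      have hcl : tsupport (χ n) ⊆ {y : H | ⟪y - z, ν⟫ ≤ -ε n} := by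
        refine closure_minimal (fun x hx => ?_) (isClosed_le (by fun_prop) continuous_const)
        by_contra hlt
        simp only [mem_setOf_eq, not_le] at hlt
        exact hx ((hχp n).2.2.1 x hlt.le)
      exact hcl hyχ
    exact ⟨hθs hyθ, by show ⟪y - z, ν⟫ < 0; linarith [hε n]⟩
  -- the identity for each `n`
  have hId : ∀ n, ∫ y in (U : Set H), (χ n y * fderiv ℝ θ y τ) • f y ∂μ =
      -∫ y in (U : Set H), (θ y * χ n y) • f' y ∂μ := fun n => by
    have h := hf.integral_eq _ (htest n)
    have hχd : Differentiable ℝ (χ n) := (hχp n).1.differentiable (by simp)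
    have e : ∀ y, fderiv ℝ (fun y => θ y * χ n y) y τ +
        VectorCalculus.divergence (fun _ : H => τ) y * (θ y * χ n y) = χ n y * fderiv ℝ θ y τ :=
      fun y => by
        rw [HasWeakDerivAlong.divergence_const_field, zero_mul, add_zero,
          fderiv_fun_mul (hθd y) (hχd y)]
        simp only [add_apply, FunLike.coe_smul, Pi.smul_apply,
          smul_eq_mul, (hχp n).2.2.2.2 τ hτ y, mul_zero, zero_add]
    simp_rw [e] at h
    exact h
  -- dominated convergence on both sides
  have hΦi : Integrable (fun y => (fderiv ℝ θ y τ) • f y) (μ.restrict (U : Set H)) :=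
    hfi.bdd_smul CD hDθc.aestronglyMeasurable (Eventually.of_forall hCD)
  have hΨi : Integrable (fun y => θ y • f' y) (μ.restrict (U : Set H)) :=
    hf'i.bdd_smul Cθ hθ.continuous.aestronglyMeasurable (Eventually.of_forall hCθ)
  have hχev : ∀ y ∈ (U : Set H), ∀ᶠ n in atTop, χ n y = 1 := fun y hy => by
    have hs : ⟪y - z, ν⟫ < 0 := hy.2
    have hev : ∀ᶠ n in atTop, ε n ≤ -⟪y - z, ν⟫ / 2 :=
      (tendsto_order.1 hεlim).2 _ (by linarith) |>.mono fun n hn => hn.le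
    exact hev.mono fun n hn => (hχp n).2.2.2.1 y (by linarith)
  have hL : Tendsto (fun n => ∫ y in (U : Set H), (χ n y * fderiv ℝ θ y τ) • f y ∂μ) atTop
      (𝓝 (∫ y in (U : Set H), (fderiv ℝ θ y τ) • f y ∂μ)) := by
    refine tendsto_integral_of_dominated_convergence (fun y => ‖(fderiv ℝ θ y τ) • f y‖)
      (fun n => ?_) hΦi.norm (fun n => Eventually.of_forall fun y => ?_) ?_
    · exact (((hχp n).1.continuous.mul hDθc).aestronglyMeasurable).smul hfi.aestronglyMeasurable
    · rw [mul_smul, norm_smul, Real.norm_eq_abs, abs_of_nonneg ((hχp n).2.1 y).1]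
      exact mul_le_of_le_one_left (norm_nonneg _) ((hχp n).2.1 y).2
    · rw [ae_restrict_iff' hUm]
      refine Eventually.of_forall fun y hy => ?_
      refine tendsto_const_nhds.congr' ((hχev y hy).mono fun n hn => ?_)
      show (fderiv ℝ θ y τ) • f y = (χ n y * fderiv ℝ θ y τ) • f y
      rw [hn, one_mul]
  have hR : Tendsto (fun n => -∫ y in (U : Set H), (θ y * χ n y) • f' y ∂μ) atTop
      (𝓝 (-∫ y in (U : Set H), θ y • f' y ∂μ)) := by
    refine Tendsto.neg ?_
    refine tendsto_integral_of_dominated_convergence (fun y => ‖θ y • f' y‖)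
      (fun n => ?_) hΨi.norm (fun n => Eventually.of_forall fun y => ?_) ?_
    · exact ((hθ.continuous.mul (hχp n).1.continuous).aestronglyMeasurable).smul hf'i.aestronglyMeasurable
    · rw [mul_comm, mul_smul, norm_smul, Real.norm_eq_abs, abs_of_nonneg ((hχp n).2.1 y).1]
      exact mul_le_of_le_one_left (norm_nonneg _) ((hχp n).2.1 y).2
    · rw [ae_restrict_iff' hUm]
      refine Eventually.of_forall fun y hy => ?_
      refine tendsto_const_nhds.congr' ((hχev y hy).mono fun n hn => ?_)
      show θ y • f' y = (θ y * χ n y) • f' y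
      rw [hn, mul_one]
  exact tendsto_nhds_unique hL (by simp_rw [hId]; exact hR)

omit [CompleteSpace W] in
/-- **Tangential integration by parts for `W^{1,1}_{loc}` functions on the half-ball** (the
Fréchet form): for `f` weakly differentiable on `U` with `f`, `Df τ` integrable, `τ` tangential and
`θ ∈ C_c^∞(B(z,ρ))`, `∫_U (∂_τ θ) f = -∫_U θ (Df τ)`. [cite: Evans2010, §6.3.2 Theorem 5 (proof)] -/
theorem _root_.Literature.Analysis.FunctionSpaces.HasWeakFDerivOn.integral_tangential_halfBall
    {μ : Measure H} {ν z : H} {ρ : ℝ} {τ : H}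
    (hτ : ⟪τ, ν⟫ = 0) {f : H → W} {Df : H → H →L[ℝ] W}
    (hf : HasWeakFDerivOn (halfBall ν z ρ) μ f Df)
    (hfi : IntegrableOn f (halfBall ν z ρ : Set H) μ)
    (hf'i : IntegrableOn (fun y => Df y τ) (halfBall ν z ρ : Set H) μ)
    {θ : H → ℝ} (hθ : ContDiff ℝ ∞ θ) (hθc : HasCompactSupport θ) (hθs : tsupport θ ⊆ ball z ρ) :
    ∫ y in (halfBall ν z ρ : Set H), (fderiv ℝ θ y τ) • f y ∂μ =
      -∫ y in (halfBall ν z ρ : Set H), θ y • Df y τ ∂μ :=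
  (hf.hasWeakDerivAlong contDiff_const).integral_tangential_halfBall hτ hfi hf'i hθ hθc hθs

/-! ### Symmetry of the weak Hessian -/

omit [FiniteDimensional ℝ H] [BorelSpace H] in
/-- **Weak second derivatives are symmetric a.e.**: if `⟪∇u, ·⟫` is the weak derivative of `u` and
`D∇u` a weak derivative of `∇u` on `Ω`, then `⟪a, D∇u(y) c⟫ = ⟪c, D∇u(y) a⟫` for a.e. `y ∈ Ω`
(`hasWeakDerivAlong_inner_swap` and a.e. uniqueness of weak derivatives). [folklore] -/
theorem ae_inner_weakHessian_symm [FiniteDimensional ℝ H] [BorelSpace H] {Ω : Opens H}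
    {μ : Measure H} {u : H → ℝ} {gu : H → H}
    {Dgu : H → H →L[ℝ] H} (hu : HasWeakFDerivOn Ω μ u (fun y => innerSL ℝ (gu y)))
    (hgu : LocallyIntegrableOn gu (Ω : Set H) μ) (hD : HasWeakFDerivOn Ω μ gu Dgu) (a c : H) :
    (fun y => ⟪a, Dgu y c⟫) =ᵐ[μ.restrict (Ω : Set H)] fun y => ⟪c, Dgu y a⟫ := by
  have h1 : HasWeakDerivAlong Ω μ (fun _ => c) (fun y => ⟪a, gu y⟫) (fun y => ⟪a, Dgu y c⟫) := by
    have := (hD.hasWeakDerivAlong contDiff_const (X := fun _ => c)).clm_apply contDiff_const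
      (innerSL ℝ a)
    simpa only [innerSL_apply_apply] using this
  have h2' : HasWeakDerivAlong Ω μ (fun _ => a) (fun y => ⟪c, gu y⟫) (fun y => ⟪c, Dgu y a⟫) := by
    have := (hD.hasWeakDerivAlong contDiff_const (X := fun _ => a)).clm_apply contDiff_const
      (innerSL ℝ c)
    simpa only [innerSL_apply_apply] using this
  have h2 := hasWeakDerivAlong_inner_swap hu hgu h2'
  exact h1.ae_eq h2

/-- **The gradient of a component of the gradient**: with the notation of
`ae_inner_weakHessian_symm`, `y ↦ ⟪D∇u(y) τ, ·⟫` is the weak derivative of `⟪τ, ∇u⟫` on `Ω` (the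
symmetric form of `⟪τ, D∇u(y) ·⟫`). [folklore] -/
theorem hasWeakFDerivOn_const_inner_grad {Ω : Opens H} {μ : Measure H} {u : H → ℝ} {gu : H → H}
    {Dgu : H → H →L[ℝ] H} (hu : HasWeakFDerivOn Ω μ u (fun y => innerSL ℝ (gu y)))
    (hgu : LocallyIntegrableOn gu (Ω : Set H) μ) (hD : HasWeakFDerivOn Ω μ gu Dgu) (τ : H) :
    HasWeakFDerivOn Ω μ (fun y => ⟪τ, gu y⟫) (fun y => innerSL ℝ (Dgu y τ)) := by
  set b := stdOrthonormalBasis ℝ H with hb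
  have h0 := hD.clm_comp (innerSL ℝ τ)
  have hsym : ∀ᵐ y ∂(μ.restrict (Ω : Set H)), ∀ i, ⟪τ, Dgu y (b i)⟫ = ⟪b i, Dgu y τ⟫ :=
    ae_all_iff.2 fun i => ae_inner_weakHessian_symm hu hgu hD τ (b i)
  refine MeyersSerrin.hasWeakFDerivOn_congr_ae h0 (Eventually.of_forall fun y => ?_) (hsym.mono fun y hy => ?_)
  · simp only [innerSL_apply_apply]
  · ext v
    rw [innerSL_apply_apply, ContinuousLinearMap.comp_apply, innerSL_apply_apply]
    have e1 := clm_apply_expand b ((innerSL ℝ τ).comp (Dgu y)) v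
    simp only [ContinuousLinearMap.comp_apply, innerSL_apply_apply] at e1
    rw [e1, ← b.sum_inner_mul_inner (Dgu y τ) v]
    refine Finset.sum_congr rfl fun i _ => ?_
    rw [hy i, real_inner_comm (Dgu y τ) (b i), mul_comm]

/-! ### Applying a smooth field of linear maps -/

/-- **A smooth field of linear maps applied to a Sobolev vector field**: for `B : H → (H →L[ℝ] H)`
smooth and `f ∈ W^{k,2}(Ω; H)` on a bounded `Ω`, `y ↦ B(y)(f y) ∈ W^{k,2}(Ω; H)` (expand along an
orthonormal basis; smooth multiplication and linearity). [folklore] -/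
theorem memSobolevDomain_clmField_apply {Ω : Opens H} {μ : Measure H} {k : ℕ}
    (hb : Bornology.IsBounded (Ω : Set H)) {B : H → H →L[ℝ] H} (hB : ContDiff ℝ ∞ B) {f : H → H}
    (hf : MemSobolevDomain k 2 Ω μ f) : MemSobolevDomain k 2 Ω μ (fun y => B y (f y)) := by
  set b := stdOrthonormalBasis ℝ H with hbb
  have hcoef : ∀ l j, ContDiff ℝ ∞ fun y => ⟪b l, B y (b j)⟫ := fun l j =>
    contDiff_const.inner ℝ (hB.clm_apply contDiff_const)
  have e : (fun y => B y (f y)) = fun y => ∑ j, ∑ l, (⟪b l, B y (b j)⟫ * ⟪b j, f y⟫) • b l := by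
    funext y
    conv_lhs => rw [← b.sum_repr' (f y), map_sum]
    refine Finset.sum_congr rfl fun j _ => ?_
    rw [map_smul]
    conv_lhs => rw [← b.sum_repr' (B y (b j)), Finset.smul_sum]
    refine Finset.sum_congr rfl fun l _ => ?_
    rw [smul_smul, mul_comm]
  rw [e]
  refine memSobolevDomain_finsetSum _ fun j _ => memSobolevDomain_finsetSum _ fun l _ => ?_
  exact (((hf.const_inner (b j)).smooth_mul hb (hcoef l j))).smul_const (b l)

/-- **A smooth field of linear maps applied to a weakly differentiable vector field, paired with a
constant vector**: if `g'` is a weak derivative of `g` along the constant field `X` on `Ω` and `B` is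
smooth, then `y ↦ ⟪c, B(y)(g y)⟫` has the weak derivative `⟪c, (∂_X B)(y)(g y)⟫ + ⟪c, B(y)(g' y)⟫`
along `X`. [folklore] -/
theorem _root_.Literature.Analysis.FluidPDE.HasWeakDerivAlong.const_inner_clmField_apply {Ω : Opens H} {μ : Measure H} {X : H}
    {g g' : H → H} (hg : HasWeakDerivAlong Ω μ (fun _ => X) g g') {B : H → H →L[ℝ] H}
    (hB : ContDiff ℝ ∞ B) (c : H) :
    HasWeakDerivAlong Ω μ (fun _ => X) (fun y => ⟪c, B y (g y)⟫)
      (fun y => ⟪c, (fderiv ℝ B y X) (g y)⟫ + ⟪c, B y (g' y)⟫) := by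
  set b := stdOrthonormalBasis ℝ H with hbb
  have hX1 : ContDiff ℝ 1 (fun _ : H => X) := contDiff_const
  have hcoef : ∀ j, ContDiff ℝ ∞ fun y => ⟪c, B y (b j)⟫ := fun j =>
    contDiff_const.inner ℝ (hB.clm_apply contDiff_const)
  have hdcoef : ∀ j y, fderiv ℝ (fun y => ⟪c, B y (b j)⟫) y X = ⟪c, fderiv ℝ B y X (b j)⟫ :=
    fun j y => by
      have hBd : DifferentiableAt ℝ B y := (hB.differentiable (by simp)) y
      rw [fderiv_inner_apply ℝ (differentiableAt_const c) (hBd.clm_apply (differentiableAt_const _)),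
        fderiv_fun_const, Pi.zero_apply, zero_apply, inner_zero_left, add_zero,
        fderiv_clm_apply hBd (differentiableAt_const _)]
      simp
  have hs : ∀ j, HasWeakDerivAlong Ω μ (fun _ => X) (fun y => ⟪b j, g y⟫) (fun y => ⟪b j, g' y⟫) :=
    fun j => by
      have := hg.clm_apply hX1 (innerSL ℝ (b j))
      simpa only [innerSL_apply_apply] using this
  have hterm : ∀ j, HasWeakDerivAlong Ω μ (fun _ => X) (fun y => ⟪c, B y (b j)⟫ • ⟪b j, g y⟫)
      (fun y => (fderiv ℝ (fun y => ⟪c, B y (b j)⟫) y X) • ⟪b j, g y⟫ + ⟪c, B y (b j)⟫ • ⟪b j, g' y⟫) :=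
    fun j => (hs j).smul hX1 (hcoef j)
  have hsum := HasWeakDerivAlong.finset_sum hX1 Finset.univ (fun j _ => hterm j)
  refine (hsum.congr (Eventually.of_forall fun y => ?_)).congr_deriv (Eventually.of_forall fun y => ?_)
  · show ∑ j, ⟪c, B y (b j)⟫ • ⟪b j, g y⟫ = ⟪c, B y (g y)⟫
    rw [inner_clm_apply_expand b (B y) c (g y)]
    simp only [smul_eq_mul]
  · show ∑ j, ((fderiv ℝ (fun y => ⟪c, B y (b j)⟫) y X) • ⟪b j, g y⟫ + ⟪c, B y (b j)⟫ • ⟪b j, g' y⟫) =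
        ⟪c, (fderiv ℝ B y X) (g y)⟫ + ⟪c, B y (g' y)⟫
    simp only [smul_eq_mul, hdcoef, Finset.sum_add_distrib]
    rw [inner_clm_apply_expand b (fderiv ℝ B y X) c (g y), inner_clm_apply_expand b (B y) c (g' y)]

end Literature.Analysis.PDE

end
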